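import Literature.MathematicalPhysics.QuantumLattice.DWaveSourceEnergyDensityTPrimeTransport
import Literature.MathematicalPhysics.QuantumLattice.DWaveSourceEnergyDensityEnsembles
import Literature.MathematicalPhysics.QuantumLattice.HubbardTTPrimeKinematicRowsAllFillings
import Literature.MathematicalPhysics.QuantumLattice.HubbardTTPrimeTwoColumnCaps
import Literature.MathematicalPhysics.QuantumLattice.HubbardTTPrimeBoxTransport
import Literature.MathematicalPhysics.QuantumLattice.InfVolFermionStateWeakLimits
import HarnessLib

/-!
# `d`-wave order-parameter CEILINGS over `t'`-INTERVALS and `(t', U, μ)` CELLS from TWO anchors: sourced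
# floors interpolate by concavity (zero loss), source-free caps pay a tangent / kinematic `16/π²` bulge or
# come from the canonical `t'`-cell words; the sourced `t'`-Lipschitz constant `4 → 16/π²`

Topic `Literature/MathematicalPhysics/QuantumLattice` (namespace = path; family `hubbard`). Sequel of
`DWaveSourceEnergyDensityTPrimeTransport.lean` (hubbard-cq-p5: the `t'`-axis of the sourced dictionary from ONE
anchor with the operator-norm constant `4`: `|e_src(t') − e_src(t'')| ≤ 4|t' − t''|`, ABSENT boxes of radius
`8|Δt'| + |ΔU| + 2|Δμ| < 2h·m₀ − (hi₀ − lo)`), written from the `t'`-box lane of the fast cell (`pub/hubbard-fast`,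
seat hubbard-box-p3: «`t'`-boxes transport from the `t' ∈ {0, −1/4}` anchors»). Objects (all in the tree):
`E(s,U,μ,h) := dWaveSourceEnergyDensityTT' s U μ h` (thermodynamic-limit ground-state energy density of the
`d`-wave pair-sourced grand-canonical `t–t'` Hubbard torus, JOINTLY CONCAVE in `(s,U,μ,h)`,
`DWaveSourceEnergyDensityCouplings`), `m⋆(s,U,μ) := dWaveOrderParameterTT' s U μ` (Koma–Tasaki order parameter,
`= ⨅_{h>0} (E(·,0) − E(·,h))/(2h)`), `K₂(ω) := ω.meanEnergy (hubbardTTPrimeFermionInteraction 0 1 0) 1` (diagonal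
hopping energy per site), `e(1,s,U,n) := energyDensityTT' 1 s U n` (canonical density). A material `t'`-BOX of the
phase map (cell value «`d`-wave order `≤ x`» / ABSENT(`< m₀`)) is served from the TWO cuprate anchors `s₁ = −1/4`,
`s₂ = 0` as follows.

* §1 THE KINEMATIC CONSTANT IS `16/π²`, NOT `4`. The tangent at a translation-invariant minimiser (cq-p5's
  `dWaveSourceEnergyDensityTT'_le_add_mul_diagHop_of_minimiser`) read with the filling-free translation-invariant
  row `|K₂(ω)| ≤ 16/π²` (hubbard-box-p1, `IsTranslationInvariant.abs_meanEnergy_diagHop_le_of_any_density`):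
  **`abs_dWaveSourceEnergyDensityTT'_sub_tp_le_kinematic`: `|E(t') − E(t'')| ≤ (16/π²)|t' − t''|`** (all
  `U, μ, h`), window transport, the secant numerator moves `≤ (32/π²)|Δt'|`, and cq-p5's one-anchor ceilings with
  `8 → 32/π² = 3.24…` (`dWaveOrderParameterTT'_le_of_windows_couplings3_kinematic`, `…_tp_box_kinematic`,
  `…_lt_of_windows_near3_kinematic`): the one-anchor ABSENT radius in `t'` grows by the factor `π²/4 = 2.47`.
* §2 TWO-ANCHOR INTERVAL FLOORS (concavity, ZERO loss): `lo₁ ≤ E(s₁,·)`, `lo₂ ≤ E(s₂,·)` ⇒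
  `min lo₁ lo₂ ≤ E(s,·)` and the chord on `[s₁,s₂]` (`dWaveSourceEnergyDensityTT'_tPrime_interval_ge`,
  `…_ge_tPrime_chord`); segment form in all four couplings (`…_segment_ge_min`).
* §3 TWO-ANCHOR INTERVAL CAPS (three price lists for the source-free / sourced cap inside `[s₁,s₂]`):
  (a) kinematic — `E(s) ≤ max hiᵢ + (16/π²)·min(s − s₁, s₂ − s) ≤ max hiᵢ + (16/π²)(s₂ − s₁)/2`;
  (b) TANGENT WORDS — if every translation-invariant sourced ground state (mean-energy minimiser) at `s₁` has
  `K₂ ≤ A` and at `s₂` has `K₂ ≥ B`: `E(s) ≤ min(hi₁ + A(s − s₁), hi₂ + (−B)(s₂ − s)) ≤ max hiᵢ + w·A⁺(−B)⁺/(A⁺ + (−B)⁺)`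
  (`w = s₂ − s₁`; the fast cell's `le_max_add_bulge_of_le_two_affine`; zero bulge when `A ≤ 0` or `B ≥ 0`);
  (c) THROUGH THE CANONICAL `t'`-CELL WORDS — `E(s,U,μ,h) ≤ e(1,s,U,n) − μn` for every filling `n` (hubbard-cq-obsth-2,
  `dWaveSourceEnergyDensityTT'_le_of_energyDensityTT'_le`), so the canonical two-column caps of
  `HubbardTTPrimeTwoColumnCaps` / `HubbardTTPrimeBoxTransport` (registry rows + `K₂` secant words) cap `E` on the interval.
* §4 **ORDER CEILINGS ON A WHOLE `t'`-INTERVAL**: for `s ∈ [s₁,s₂]`, `h > 0`,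
  `m⋆(s,U,μ) ≤ (CAP(s) − min lo₁ lo₂)/(2h)` with CAP from (a)/(b)/(c)
  (`dWaveOrderParameterTT'_tPrime_interval_le_kinematic`, `…_of_diagHopWords`, `…_of_canonical_columnWords`,
  `…_of_canonical_caps_kinematic`, `…_of_canonical_intervalCap`), the cuprate instance `[−1/4, 0]`
  (`…_cuprate_tPrime_interval_le_kinematic`: `+ 2/π²`), and ABSENT(`< m₀`) on the whole interval
  (`dWaveOrderParameterTT'_lt_on_tPrime_interval_…`); SKEW anchors certified at different `(μ, h)` (even `U`):
  the segment form `dWaveOrderParameterTT'_segment_le_of_canonicalCap` / `…_of_cap` at the interpolated field.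
  Versus one anchor at the centre (`r = w/2`): kinematic cost `(16/π²)·w/2` once instead of `8·w/2` (cq-p5) or
  `(32/π²)·w/2` (§1) — the floor side is free.
* §5 `(t', U, μ)` CELLS from FOUR certificates: `E` is non-decreasing in `U` and non-increasing in `μ`
  (obsth-2, `dWaveSourceEnergyDensityTT'_mono_U` / `…_antitone_mu`), so two FLOORS at the corners `(sᵢ, U₁, μ₂)` and two
  source-free CAPS at `(sᵢ, U₂, μ₁)` serve the whole cell `[s₁,s₂] × [U₁,U₂] × [μ₁,μ₂]` — no kinematic constant in
  `U` or `μ` (`dWaveOrderParameterTT'_rect_le_…`, `dWaveOrderParameterTT'_box₃_le_…`, ABSENT cells).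
* §6 Decimal readings (`16/π² < 1.6212`, `2/π² < 0.2027`, `32/π² < 3.2424`).

HONEST SCOPE: ceiling-side bookkeeping for the ABSENT / «`≤ x`» cells of the phase map; nothing here floors `d`-wave
order anywhere (u.s.c. is all the order parameter has, `DWaveOrderParameterSemicontinuity`); every number a consumer
gets is conditional on the anchor certificates it feeds in. Everything is PROVED; no definition, no named fact, zero
compute, no `sorry`.

## References
* R. B. Israel, *Convexity in the Theory of Lattice Gases* (1979), Thm. I.3.4 (concavity and Lipschitz continuity
  of the thermodynamic functional in the interaction; tangent functionals at a minimiser). [cite: Israel1979, Thm. I.3.4]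
* R. B. Griffiths, J. Math. Phys. 5 (1964) 1215, §II (secant / chord bounds for concave thermodynamic functions).
  [cite: Griffiths1964, §II]
* T. Koma, H. Tasaki, J. Stat. Phys. 76 (1994) 745–803, §1 (the quasi-average order parameter). [cite: KomaTasaki1994, §1]
* E. H. Lieb, M. Loss, Duke Math. J. 71 (1993) 337, §8 Thm. 8.2 (bathtub; the `16/π²` row). [cite: LiebLoss1993, §8, Theorem 8.2]
* D. Ruelle, *Statistical Mechanics: Rigorous Results* (1969), §3.4 (Legendre duality canonical / grand canonical).
  [cite: Ruelle1969, §3.4]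
-/

noncomputable section

namespace Literature.MathematicalPhysics.QuantumLattice

open _root_.Matrix Finset Set HubbardWave0 Literature.Probability.LatticeModels ThermodynamicLimit _root_.Filter
open scoped _root_.Topology

/-! ### §1 The kinematic `t'`-constant of the sourced energy density is `16/π²` -/

section Kinematic

/-- **Tangent in `t'` at a sourced ground state, minimiser form**: if `ω` minimises the mean energy of the sourced
interaction at `(s,U,μ,h)` then `E(s',U,μ,h) ≤ E(s,U,μ,h) + (s' − s)·K₂(ω)` for every `s'` (cq-p5's tangent lemma,
whose hypothesis `Re ω(E^src) = E` is the minimiser property). [cite: Israel1979, Thm. I.3.4] -/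
theorem InfVolFermionState.IsMeanEnergyMinimiser.dWaveSourceEnergyDensityTT'_le_add_mul_diagHop {s U μ h : ℝ}
    {ω : InfVolFermionState 2}
    (hω : ω.IsMeanEnergyMinimiser (hubbardTTPrimeSourcedInteraction 1 s U μ dWaveFormFactor h) 1) (s' : ℝ) :
    dWaveSourceEnergyDensityTT' s' U μ h ≤
      dWaveSourceEnergyDensityTT' s U μ h + (s' - s) * ω.meanEnergy (hubbardTTPrimeFermionInteraction 0 1 0) 1 := by
  have hωe : (ω.expect dWaveSourceWindow (dWaveSourceEnergyObsTT' s U μ h)).re = dWaveSourceEnergyDensityTT' s U μ h := by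
    rw [ω.re_expect_dWaveSourceEnergyObsTT' s U μ h, hω.meanEnergy_eq,
      dWaveSourceEnergyDensityTT'_eq_tiGroundEnergyDensity]
  exact dWaveSourceEnergyDensityTT'_le_add_mul_diagHop_of_minimiser U μ h hω.1 hωe s'

/-- **One-sided kinematic step in `t'`**: `E(t'',U,μ,h) ≤ E(t',U,μ,h) + (16/π²)|t'' − t'|` — the tangent at a
translation-invariant minimiser (which exists) and the filling-free translation-invariant row `|K₂| ≤ 16/π²`.
[cite: LiebLoss1993, §8, Theorem 8.2] -/
theorem dWaveSourceEnergyDensityTT'_le_add_kinematic_mul_abs_sub_tp (U μ h t' t'' : ℝ) :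
    dWaveSourceEnergyDensityTT' t'' U μ h ≤
      dWaveSourceEnergyDensityTT' t' U μ h + 16 / Real.pi ^ 2 * |t'' - t'| := by
  obtain ⟨ω, hω, hωe⟩ := exists_re_expect_eq_dWaveSourceEnergyDensityTT' t' U μ h
  have h1 := dWaveSourceEnergyDensityTT'_le_add_mul_diagHop_of_minimiser U μ h hω hωe t''
  have h2 := hω.abs_meanEnergy_diagHop_le_of_any_density
  have h4 : (t'' - t') * ω.meanEnergy (hubbardTTPrimeFermionInteraction 0 1 0) 1 ≤
      |t'' - t'| * |ω.meanEnergy (hubbardTTPrimeFermionInteraction 0 1 0) 1| := by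
    rw [← abs_mul]
    exact le_abs_self _
  have h5 : |t'' - t'| * |ω.meanEnergy (hubbardTTPrimeFermionInteraction 0 1 0) 1| ≤
      |t'' - t'| * (16 / Real.pi ^ 2) := mul_le_mul_of_nonneg_left h2 (abs_nonneg _)
  linarith

/-- **`E` is `(16/π²)`-Lipschitz in `t'`**: `|E(t',U,μ,h) − E(t'',U,μ,h)| ≤ (16/π²)|t' − t''|` for all real
`t', t'', U, μ, h` (cq-p5's constant `4` divided by `π²/4`). [cite: Israel1979, Thm. I.3.4] -/
theorem abs_dWaveSourceEnergyDensityTT'_sub_tp_le_kinematic (U μ h t' t'' : ℝ) :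
    |dWaveSourceEnergyDensityTT' t' U μ h - dWaveSourceEnergyDensityTT' t'' U μ h| ≤ 16 / Real.pi ^ 2 * |t' - t''| := by
  have h1 := dWaveSourceEnergyDensityTT'_le_add_kinematic_mul_abs_sub_tp U μ h t' t''
  have h2 := dWaveSourceEnergyDensityTT'_le_add_kinematic_mul_abs_sub_tp U μ h t'' t'
  rw [abs_sub_comm t'' t'] at h1
  rw [abs_le]
  constructor <;> linarith

/-- **Window transport, FLOOR along `t'` (kinematic `16/π²`)**: `lo ≤ E(t') ⇒ lo − (16/π²)|t'' − t'| ≤ E(t'')`.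
[cite: Israel1979, Thm. I.3.4] -/
theorem dWaveSourceEnergyDensityTT'_ge_of_ge_tp_kinematic {U μ h t' lo : ℝ}
    (hlo : lo ≤ dWaveSourceEnergyDensityTT' t' U μ h) (t'' : ℝ) :
    lo - 16 / Real.pi ^ 2 * |t'' - t'| ≤ dWaveSourceEnergyDensityTT' t'' U μ h := by
  have h1 := dWaveSourceEnergyDensityTT'_le_add_kinematic_mul_abs_sub_tp U μ h t'' t'
  rw [abs_sub_comm t' t''] at h1
  linarith

/-- **Window transport, CEILING along `t'` (kinematic `16/π²`)**: `E(t') ≤ hi ⇒ E(t'') ≤ hi + (16/π²)|t'' − t'|`.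
[cite: Israel1979, Thm. I.3.4] -/
theorem dWaveSourceEnergyDensityTT'_le_of_le_tp_kinematic {U μ h t' hi : ℝ}
    (hhi : dWaveSourceEnergyDensityTT' t' U μ h ≤ hi) (t'' : ℝ) :
    dWaveSourceEnergyDensityTT' t'' U μ h ≤ hi + 16 / Real.pi ^ 2 * |t'' - t'| := by
  have h1 := dWaveSourceEnergyDensityTT'_le_add_kinematic_mul_abs_sub_tp U μ h t' t''
  linarith

/-- **The secant numerator moves by at most `(32/π²)|t'' − t'|` along `t'`** (both energies pay `16/π²`; no
monotonicity in `t'`). [cite: Israel1979, Thm. I.3.4] -/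
theorem secant_dWaveSourceEnergyDensityTT'_sub_tp_le_kinematic (U μ h₀ h t' t'' : ℝ) :
    (dWaveSourceEnergyDensityTT' t'' U μ h₀ - dWaveSourceEnergyDensityTT' t'' U μ h) -
      (dWaveSourceEnergyDensityTT' t' U μ h₀ - dWaveSourceEnergyDensityTT' t' U μ h) ≤ 32 / Real.pi ^ 2 * |t'' - t'| := by
  have h1 := dWaveSourceEnergyDensityTT'_le_add_kinematic_mul_abs_sub_tp U μ h₀ t' t''
  have h2 := dWaveSourceEnergyDensityTT'_le_add_kinematic_mul_abs_sub_tp U μ h t'' t'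
  rw [abs_sub_comm t' t''] at h2
  have h3 : 32 / Real.pi ^ 2 * |t'' - t'| = 2 * (16 / Real.pi ^ 2 * |t'' - t'|) := by ring
  linarith

/-- **Quantitative upper semicontinuity in all three couplings, kinematic `t'`-constant `32/π²`**: for `h > 0`,
`m⋆(t'',U',μ') ≤ (E(t',U,μ,0) − E(t',U,μ,h) + (32/π²)|t'' − t'| + |U' − U| + 2|μ' − μ|)/(2h)`.
[cite: KomaTasaki1994, §1] -/
theorem dWaveOrderParameterTT'_le_slope_add_of_couplings3_kinematic (t' U μ t'' U' μ' : ℝ) {h : ℝ}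
    (hh : 0 < h) :
    dWaveOrderParameterTT' t'' U' μ' ≤
      (dWaveSourceEnergyDensityTT' t' U μ 0 - dWaveSourceEnergyDensityTT' t' U μ h + 32 / Real.pi ^ 2 * |t'' - t'| +
        |U' - U| + 2 * |μ' - μ|) / (2 * h) := by
  have h1 := dWaveOrderParameterTT'_le_slope_add_of_couplings t'' U μ U' μ' hh
  have h2 := secant_dWaveSourceEnergyDensityTT'_sub_tp_le_kinematic U μ 0 h t' t''
  refine h1.trans (div_le_div_of_nonneg_right ?_ (by positivity))
  linarith

/-- **ONE-ANCHOR BOX-CELL CEILING in `(t', U, μ)`, kinematic `t'`-constant `32/π²`**: `E(t',U,μ,0) ≤ hi₀` and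
`lo ≤ E(t',U,μ,h)` (`h > 0`) at ONE coupling point give, for ALL `(t'', U', μ')`,
`m⋆(t'',U',μ') ≤ (hi₀ − lo + (32/π²)|t'' − t'| + |U' − U| + 2|μ' − μ|)/(2h)` (cq-p5's `…_couplings3` with `8 → 32/π²`).
[cite: Israel1979, Thm. I.3.4] -/
theorem dWaveOrderParameterTT'_le_of_windows_couplings3_kinematic {t' U μ h hi₀ lo : ℝ} (hh : 0 < h)
    (hhi : dWaveSourceEnergyDensityTT' t' U μ 0 ≤ hi₀) (hlo : lo ≤ dWaveSourceEnergyDensityTT' t' U μ h)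
    (t'' U' μ' : ℝ) :
    dWaveOrderParameterTT' t'' U' μ' ≤
      (hi₀ - lo + 32 / Real.pi ^ 2 * |t'' - t'| + |U' - U| + 2 * |μ' - μ|) / (2 * h) := by
  refine (dWaveOrderParameterTT'_le_slope_add_of_couplings3_kinematic t' U μ t'' U' μ' hh).trans ?_
  exact div_le_div_of_nonneg_right (by linarith) (by positivity)

/-- The one-anchor `t'`-box form at fixed `(U, μ)`, kinematic: `|t'' − t'| ≤ r ⇒ m⋆(t'',U,μ) ≤ (hi₀ − lo + (32/π²)r)/(2h)`.
[cite: Israel1979, Thm. I.3.4] -/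
theorem dWaveOrderParameterTT'_le_of_windows_tp_box_kinematic {t' U μ h hi₀ lo r : ℝ} (hh : 0 < h)
    (hhi : dWaveSourceEnergyDensityTT' t' U μ 0 ≤ hi₀) (hlo : lo ≤ dWaveSourceEnergyDensityTT' t' U μ h)
    {t'' : ℝ} (hr : |t'' - t'| ≤ r) :
    dWaveOrderParameterTT' t'' U μ ≤ (hi₀ - lo + 32 / Real.pi ^ 2 * r) / (2 * h) := by
  have key := dWaveOrderParameterTT'_le_of_windows_couplings3_kinematic hh hhi hlo t'' U μ
  rw [sub_self, sub_self, abs_zero, mul_zero, add_zero, add_zero] at key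
  have hκ : (0 : ℝ) ≤ 32 / Real.pi ^ 2 := by positivity
  have hκr : 32 / Real.pi ^ 2 * |t'' - t'| ≤ 32 / Real.pi ^ 2 * r := mul_le_mul_of_nonneg_left hr hκ
  exact key.trans (div_le_div_of_nonneg_right (by linarith) (by positivity))

/-- **A one-anchor ABSENT(`< m₀`) certificate on the explicit kinematic box**: if
`(32/π²)|t'' − t'| + |U' − U| + 2|μ' − μ| < 2h·m₀ − (hi₀ − lo)` then `m⋆(t'',U',μ') < m₀`.
[cite: Israel1979, Thm. I.3.4] -/
theorem dWaveOrderParameterTT'_lt_of_windows_near3_kinematic {t' U μ h hi₀ lo m₀ : ℝ} (hh : 0 < h)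
    (hhi : dWaveSourceEnergyDensityTT' t' U μ 0 ≤ hi₀) (hlo : lo ≤ dWaveSourceEnergyDensityTT' t' U μ h)
    {t'' U' μ' : ℝ} (hnear : 32 / Real.pi ^ 2 * |t'' - t'| + |U' - U| + 2 * |μ' - μ| < 2 * h * m₀ - (hi₀ - lo)) :
    dWaveOrderParameterTT' t'' U' μ' < m₀ := by
  refine lt_of_le_of_lt (dWaveOrderParameterTT'_le_of_windows_couplings3_kinematic hh hhi hlo t'' U' μ') ?_
  rw [div_lt_iff₀ (by positivity)]
  linarith

end Kinematic

/-! ### §2 Two-anchor interval FLOORS (joint concavity; zero loss) -/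

section Floors

/-- Barycentric floor along `t'` at fixed `(U, μ, h)`: convex weights `p, q` with `p s₁ + q s₂ = s` and floors
`loᵢ ≤ E(sᵢ)` give `p lo₁ + q lo₂ ≤ E(s)`. [cite: Griffiths1964, §II] -/
theorem dWaveSourceEnergyDensityTT'_convexComb_tp_ge {s₁ s₂ s U μ h lo₁ lo₂ p q : ℝ} (hp : 0 ≤ p) (hq : 0 ≤ q)
    (hpq : p + q = 1) (hs : p * s₁ + q * s₂ = s)
    (hlo₁ : lo₁ ≤ dWaveSourceEnergyDensityTT' s₁ U μ h) (hlo₂ : lo₂ ≤ dWaveSourceEnergyDensityTT' s₂ U μ h) :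
    p * lo₁ + q * lo₂ ≤ dWaveSourceEnergyDensityTT' s U μ h := by
  have key := dWaveSourceEnergyDensityTT'_convexComb_couplings_ge (tp₁ := s₁) (U₁ := U) (μ₁ := μ) (h₁ := h)
    (tp₂ := s₂) (U₂ := U) (μ₂ := μ) (h₂ := h) hp hq hpq
  have hU : p * U + q * U = U := by rw [← add_mul, hpq, one_mul]
  have hμ : p * μ + q * μ = μ := by rw [← add_mul, hpq, one_mul]
  have hh : p * h + q * h = h := by rw [← add_mul, hpq, one_mul]
  rw [hs, hU, hμ, hh] at key
  nlinarith [mul_le_mul_of_nonneg_left hlo₁ hp, mul_le_mul_of_nonneg_left hlo₂ hq]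

/-- **TWO-ANCHOR INTERVAL FLOOR (zero loss)**: floors `lo₁ ≤ E(s₁,U,μ,h)`, `lo₂ ≤ E(s₂,U,μ,h)` give
`min lo₁ lo₂ ≤ E(s,U,μ,h)` for every `s ∈ [s₁, s₂]` — `E` is concave in `t'`. [cite: Griffiths1964, §II] -/
theorem dWaveSourceEnergyDensityTT'_tPrime_interval_ge {s₁ s₂ s U μ h lo₁ lo₂ : ℝ} (h₁ : s₁ ≤ s) (h₂ : s ≤ s₂)
    (hlo₁ : lo₁ ≤ dWaveSourceEnergyDensityTT' s₁ U μ h) (hlo₂ : lo₂ ≤ dWaveSourceEnergyDensityTT' s₂ U μ h) :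
    min lo₁ lo₂ ≤ dWaveSourceEnergyDensityTT' s U μ h := by
  rcases eq_or_lt_of_le (h₁.trans h₂) with h12 | h12
  · have hs : s = s₁ := le_antisymm (h12 ▸ h₂) h₁
    rw [hs]
    exact (min_le_left _ _).trans hlo₁
  · have hd : 0 < s₂ - s₁ := sub_pos.2 h12
    have hp : 0 ≤ (s₂ - s) / (s₂ - s₁) := div_nonneg (sub_nonneg.2 h₂) hd.le
    have hq : 0 ≤ (s - s₁) / (s₂ - s₁) := div_nonneg (sub_nonneg.2 h₁) hd.le
    have hpq : (s₂ - s) / (s₂ - s₁) + (s - s₁) / (s₂ - s₁) = 1 := by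
      rw [← add_div, show s₂ - s + (s - s₁) = s₂ - s₁ by ring, div_self hd.ne']
    have hs : (s₂ - s) / (s₂ - s₁) * s₁ + (s - s₁) / (s₂ - s₁) * s₂ = s := by
      rw [div_mul_eq_mul_div, div_mul_eq_mul_div, ← add_div, div_eq_iff hd.ne']
      ring
    have key := dWaveSourceEnergyDensityTT'_convexComb_tp_ge hp hq hpq hs hlo₁ hlo₂
    have e1 := mul_le_mul_of_nonneg_left (min_le_left lo₁ lo₂) hp
    have e2 := mul_le_mul_of_nonneg_left (min_le_right lo₁ lo₂) hq
    have e3 : min lo₁ lo₂ = ((s₂ - s) / (s₂ - s₁) + (s - s₁) / (s₂ - s₁)) * min lo₁ lo₂ := by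
      rw [hpq, one_mul]
    rw [e3, add_mul]
    exact (add_le_add e1 e2).trans key

/-- **Chord floor between two anchors**: for `s₁ < s₂`, `s ∈ [s₁,s₂]`:
`lo₁ + (lo₂ − lo₁)(s − s₁)/(s₂ − s₁) ≤ E(s,U,μ,h)`. [cite: Griffiths1964, §II] -/
theorem dWaveSourceEnergyDensityTT'_ge_tPrime_chord {s₁ s₂ s U μ h lo₁ lo₂ : ℝ} (hlt : s₁ < s₂) (h₁ : s₁ ≤ s)
    (h₂ : s ≤ s₂) (hlo₁ : lo₁ ≤ dWaveSourceEnergyDensityTT' s₁ U μ h)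
    (hlo₂ : lo₂ ≤ dWaveSourceEnergyDensityTT' s₂ U μ h) :
    lo₁ + (lo₂ - lo₁) * (s - s₁) / (s₂ - s₁) ≤ dWaveSourceEnergyDensityTT' s U μ h := by
  have hd : 0 < s₂ - s₁ := sub_pos.2 hlt
  have hp : 0 ≤ (s₂ - s) / (s₂ - s₁) := div_nonneg (sub_nonneg.2 h₂) hd.le
  have hq : 0 ≤ (s - s₁) / (s₂ - s₁) := div_nonneg (sub_nonneg.2 h₁) hd.le
  have hpq : (s₂ - s) / (s₂ - s₁) + (s - s₁) / (s₂ - s₁) = 1 := by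
    rw [← add_div, show s₂ - s + (s - s₁) = s₂ - s₁ by ring, div_self hd.ne']
  have hs : (s₂ - s) / (s₂ - s₁) * s₁ + (s - s₁) / (s₂ - s₁) * s₂ = s := by
    rw [div_mul_eq_mul_div, div_mul_eq_mul_div, ← add_div, div_eq_iff hd.ne']
    ring
  have key := dWaveSourceEnergyDensityTT'_convexComb_tp_ge hp hq hpq hs hlo₁ hlo₂
  have heq : (s₂ - s) / (s₂ - s₁) * lo₁ + (s - s₁) / (s₂ - s₁) * lo₂ =
      lo₁ + (lo₂ - lo₁) * (s - s₁) / (s₂ - s₁) := by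
    field_simp
    ring
  rw [heq] at key
  exact key

/-- **Segment floor in all four couplings**: a point of the segment between two certified coupling points is
floored by the smaller floor (joint concavity of `E` on `ℝ⁴`). [cite: Israel1979, Thm. I.3.4] -/
theorem dWaveSourceEnergyDensityTT'_segment_ge_min {tp₁ U₁ μ₁ h₁ tp₂ U₂ μ₂ h₂ lo₁ lo₂ p q : ℝ} (hp : 0 ≤ p)
    (hq : 0 ≤ q) (hpq : p + q = 1) (hlo₁ : lo₁ ≤ dWaveSourceEnergyDensityTT' tp₁ U₁ μ₁ h₁)
    (hlo₂ : lo₂ ≤ dWaveSourceEnergyDensityTT' tp₂ U₂ μ₂ h₂) :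
    min lo₁ lo₂ ≤ dWaveSourceEnergyDensityTT' (p * tp₁ + q * tp₂) (p * U₁ + q * U₂) (p * μ₁ + q * μ₂)
      (p * h₁ + q * h₂) := by
  have key := dWaveSourceEnergyDensityTT'_convexComb_couplings_ge (tp₁ := tp₁) (U₁ := U₁) (μ₁ := μ₁) (h₁ := h₁)
    (tp₂ := tp₂) (U₂ := U₂) (μ₂ := μ₂) (h₂ := h₂) hp hq hpq
  have e1 := mul_le_mul_of_nonneg_left ((min_le_left lo₁ lo₂).trans hlo₁) hp
  have e2 := mul_le_mul_of_nonneg_left ((min_le_right lo₁ lo₂).trans hlo₂) hq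
  have e3 : min lo₁ lo₂ = (p + q) * min lo₁ lo₂ := by rw [hpq, one_mul]
  rw [e3, add_mul]
  exact (add_le_add e1 e2).trans key

end Floors

/-! ### §3 Two-anchor interval CAPS: kinematic, tangent words, canonical words -/

section Caps

/-- **(a) Kinematic interval cap**: caps `E(sᵢ,U,μ,h) ≤ hiᵢ` at `s₁ ≤ s ≤ s₂` give
`E(s,U,μ,h) ≤ max hi₁ hi₂ + (16/π²)·min(s − s₁, s₂ − s)` (the nearer anchor pays). [cite: Israel1979, Thm. I.3.4] -/
theorem dWaveSourceEnergyDensityTT'_tPrime_interval_le_kinematic {s₁ s₂ s U μ h hi₁ hi₂ : ℝ} (h₁ : s₁ ≤ s)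
    (h₂ : s ≤ s₂) (hhi₁ : dWaveSourceEnergyDensityTT' s₁ U μ h ≤ hi₁)
    (hhi₂ : dWaveSourceEnergyDensityTT' s₂ U μ h ≤ hi₂) :
    dWaveSourceEnergyDensityTT' s U μ h ≤ max hi₁ hi₂ + 16 / Real.pi ^ 2 * min (s - s₁) (s₂ - s) := by
  have e1 := dWaveSourceEnergyDensityTT'_le_of_le_tp_kinematic hhi₁ s
  have e2 := dWaveSourceEnergyDensityTT'_le_of_le_tp_kinematic hhi₂ s
  rw [abs_of_nonneg (sub_nonneg.2 h₁)] at e1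
  rw [abs_of_nonpos (sub_nonpos.2 h₂), neg_sub] at e2
  have m1 := le_max_left hi₁ hi₂
  have m2 := le_max_right hi₁ hi₂
  rcases le_total (s - s₁) (s₂ - s) with hle | hle
  · rw [min_eq_left hle]
    linarith
  · rw [min_eq_right hle]
    linarith

/-- **(a') Uniform kinematic interval cap**: `E(s,U,μ,h) ≤ max hi₁ hi₂ + (16/π²)(s₂ − s₁)/2` on `[s₁,s₂]`.
[cite: Israel1979, Thm. I.3.4] -/
theorem dWaveSourceEnergyDensityTT'_tPrime_interval_le_kinematic' {s₁ s₂ s U μ h hi₁ hi₂ : ℝ} (h₁ : s₁ ≤ s)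
    (h₂ : s ≤ s₂) (hhi₁ : dWaveSourceEnergyDensityTT' s₁ U μ h ≤ hi₁)
    (hhi₂ : dWaveSourceEnergyDensityTT' s₂ U μ h ≤ hi₂) :
    dWaveSourceEnergyDensityTT' s U μ h ≤ max hi₁ hi₂ + 16 / Real.pi ^ 2 * ((s₂ - s₁) / 2) := by
  have key := dWaveSourceEnergyDensityTT'_tPrime_interval_le_kinematic h₁ h₂ hhi₁ hhi₂
  have hmin : min (s - s₁) (s₂ - s) ≤ (s₂ - s₁) / 2 := by
    rcases le_total (s - s₁) (s₂ - s) with hle | hle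
    · rw [min_eq_left hle]; linarith
    · rw [min_eq_right hle]; linarith
  have hκ : (0 : ℝ) ≤ 16 / Real.pi ^ 2 := by positivity
  nlinarith [mul_le_mul_of_nonneg_left hmin hκ]

/-- **(b) Two tangent majorants from `K₂`-WORDS on the sourced ground states**: if every translation-invariant
mean-energy minimiser of the sourced interaction at `(s₁,U,μ,h)` has `K₂ ≤ A` and every one at `(s₂,U,μ,h)` has
`K₂ ≥ B`, then for `s ∈ [s₁,s₂]`: `E(s) ≤ min(hi₁ + A(s − s₁), hi₂ + (−B)(s₂ − s))`. [cite: Israel1979, Thm. I.3.4] -/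
theorem dWaveSourceEnergyDensityTT'_le_min_tangents_of_diagHopWords {s₁ s₂ s U μ h hi₁ hi₂ A B : ℝ}
    (h₁ : s₁ ≤ s) (h₂ : s ≤ s₂) (hhi₁ : dWaveSourceEnergyDensityTT' s₁ U μ h ≤ hi₁)
    (hhi₂ : dWaveSourceEnergyDensityTT' s₂ U μ h ≤ hi₂)
    (hA : ∀ ω : InfVolFermionState 2,
      ω.IsMeanEnergyMinimiser (hubbardTTPrimeSourcedInteraction 1 s₁ U μ dWaveFormFactor h) 1 →
        ω.meanEnergy (hubbardTTPrimeFermionInteraction 0 1 0) 1 ≤ A)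
    (hB : ∀ ω : InfVolFermionState 2,
      ω.IsMeanEnergyMinimiser (hubbardTTPrimeSourcedInteraction 1 s₂ U μ dWaveFormFactor h) 1 →
        B ≤ ω.meanEnergy (hubbardTTPrimeFermionInteraction 0 1 0) 1) :
    dWaveSourceEnergyDensityTT' s U μ h ≤ min (hi₁ + A * (s - s₁)) (hi₂ + (-B) * (s₂ - s)) := by
  obtain ⟨ω₁, hω₁⟩ := (hubbardTTPrimeSourcedInteraction 1 s₁ U μ dWaveFormFactor h).exists_isMeanEnergyMinimiser 1
  obtain ⟨ω₂, hω₂⟩ := (hubbardTTPrimeSourcedInteraction 1 s₂ U μ dWaveFormFactor h).exists_isMeanEnergyMinimiser 1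
  have t1 := hω₁.dWaveSourceEnergyDensityTT'_le_add_mul_diagHop s
  have t2 := hω₂.dWaveSourceEnergyDensityTT'_le_add_mul_diagHop s
  have a1 := hA ω₁ hω₁
  have b2 := hB ω₂ hω₂
  refine le_min ?_ ?_
  · nlinarith [mul_le_mul_of_nonneg_left a1 (sub_nonneg.2 h₁)]
  · nlinarith [mul_le_mul_of_nonneg_left b2 (sub_nonneg.2 h₂)]

/-- **(b') SIGN-AWARE BULGE from `K₂`-words**: under the hypotheses of (b),
`E(s) ≤ max hi₁ hi₂ + (s₂ − s₁)·A⁺(−B)⁺/(A⁺ + (−B)⁺)` on `[s₁,s₂]` (`x/0 = 0`: zero bulge when `A ≤ 0` or `B ≥ 0`;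
never worse than `(s₂ − s₁)·min(A⁺,(−B)⁺)`, `mul_div_add_le_min`). [cite: Israel1979, Thm. I.3.4] -/
theorem dWaveSourceEnergyDensityTT'_tPrime_interval_le_of_diagHopWords {s₁ s₂ s U μ h hi₁ hi₂ A B : ℝ}
    (h₁ : s₁ ≤ s) (h₂ : s ≤ s₂) (hhi₁ : dWaveSourceEnergyDensityTT' s₁ U μ h ≤ hi₁)
    (hhi₂ : dWaveSourceEnergyDensityTT' s₂ U μ h ≤ hi₂)
    (hA : ∀ ω : InfVolFermionState 2,
      ω.IsMeanEnergyMinimiser (hubbardTTPrimeSourcedInteraction 1 s₁ U μ dWaveFormFactor h) 1 →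
        ω.meanEnergy (hubbardTTPrimeFermionInteraction 0 1 0) 1 ≤ A)
    (hB : ∀ ω : InfVolFermionState 2,
      ω.IsMeanEnergyMinimiser (hubbardTTPrimeSourcedInteraction 1 s₂ U μ dWaveFormFactor h) 1 →
        B ≤ ω.meanEnergy (hubbardTTPrimeFermionInteraction 0 1 0) 1) :
    dWaveSourceEnergyDensityTT' s U μ h ≤
      max hi₁ hi₂ + (s₂ - s₁) * (max A 0 * max (-B) 0) / (max A 0 + max (-B) 0) := by
  have hmin := dWaveSourceEnergyDensityTT'_le_min_tangents_of_diagHopWords h₁ h₂ hhi₁ hhi₂ hA hB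
  exact le_max_add_bulge_of_le_two_affine h₁ h₂ (le_min_iff.1 hmin).1 (le_min_iff.1 hmin).2

/-- **Zero bulge, left**: if every sourced ground state at `(s₁,U,μ,h)` has `K₂ ≤ 0` then the cap at `s₁` holds for
ALL `t' ≥ s₁`: `E(t',U,μ,h) ≤ hi₁`. [cite: Israel1979, Thm. I.3.4] -/
theorem dWaveSourceEnergyDensityTT'_le_leftCap_of_diagHop_nonpos {s₁ U μ h hi₁ : ℝ}
    (hhi₁ : dWaveSourceEnergyDensityTT' s₁ U μ h ≤ hi₁)
    (hA : ∀ ω : InfVolFermionState 2,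
      ω.IsMeanEnergyMinimiser (hubbardTTPrimeSourcedInteraction 1 s₁ U μ dWaveFormFactor h) 1 →
        ω.meanEnergy (hubbardTTPrimeFermionInteraction 0 1 0) 1 ≤ 0)
    {t' : ℝ} (ht : s₁ ≤ t') : dWaveSourceEnergyDensityTT' t' U μ h ≤ hi₁ := by
  obtain ⟨ω₁, hω₁⟩ := (hubbardTTPrimeSourcedInteraction 1 s₁ U μ dWaveFormFactor h).exists_isMeanEnergyMinimiser 1
  have t1 := hω₁.dWaveSourceEnergyDensityTT'_le_add_mul_diagHop t'
  nlinarith [mul_le_mul_of_nonneg_left (hA ω₁ hω₁) (sub_nonneg.2 ht)]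

/-- **Zero bulge, right**: if every sourced ground state at `(s₂,U,μ,h)` has `K₂ ≥ 0` then the cap at `s₂` holds
for ALL `t' ≤ s₂`: `E(t',U,μ,h) ≤ hi₂`. [cite: Israel1979, Thm. I.3.4] -/
theorem dWaveSourceEnergyDensityTT'_le_rightCap_of_diagHop_nonneg {s₂ U μ h hi₂ : ℝ}
    (hhi₂ : dWaveSourceEnergyDensityTT' s₂ U μ h ≤ hi₂)
    (hB : ∀ ω : InfVolFermionState 2,
      ω.IsMeanEnergyMinimiser (hubbardTTPrimeSourcedInteraction 1 s₂ U μ dWaveFormFactor h) 1 →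
        0 ≤ ω.meanEnergy (hubbardTTPrimeFermionInteraction 0 1 0) 1)
    {t' : ℝ} (ht : t' ≤ s₂) : dWaveSourceEnergyDensityTT' t' U μ h ≤ hi₂ := by
  obtain ⟨ω₂, hω₂⟩ := (hubbardTTPrimeSourcedInteraction 1 s₂ U μ dWaveFormFactor h).exists_isMeanEnergyMinimiser 1
  have t2 := hω₂.dWaveSourceEnergyDensityTT'_le_add_mul_diagHop t'
  nlinarith [mul_le_mul_of_nonneg_left (hB ω₂ hω₂) (sub_nonneg.2 ht)]

/-- **(c) Through the CANONICAL two-column cap with `K₂` secant/SDP words**: canonical caps `e(1,sᵢ,U,n) ≤ Rᵢ`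
(`U ≥ 0`, `0 ≤ n < 2`) and canonical column words (`K₂ ≤ A` on the torus-limit ground states at `s₁`, `K₂ ≥ B` at
`s₂`, the hypotheses of `energyDensityTT'_tPrime_interval_le_of_columnWords`) cap the sourced density at every
chemical potential and source: `E(s,U,μ,h) ≤ max R₁ R₂ + (s₂ − s₁)·A⁺(−B)⁺/(A⁺ + (−B)⁺) − μn` on `[s₁,s₂]`
(Legendre: `E(s,U,μ,h) ≤ e(1,s,U,n) − μn`). [cite: Ruelle1969, §3.4] -/
theorem dWaveSourceEnergyDensityTT'_tPrime_interval_le_of_canonical_columnWords {U : ℝ} (hU : 0 ≤ U) {n : ℝ}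
    (hn0 : 0 ≤ n) (hn2 : n < 2) (μ h : ℝ) {s₁ s₂ R₁ R₂ A B : ℝ}
    (hR₁ : energyDensityTT' 1 s₁ U n ≤ R₁) (hR₂ : energyDensityTT' 1 s₂ U n ≤ R₂)
    (hA : ∀ (ω₁ : InfVolFermionState 2) (Ls₁ : ℕ → ℕ) (ψ₁ : ∀ L, Fock (Orb (FermionTorus 2 L))),
      Tendsto Ls₁ atTop atTop →
      (∀ j, IsGroundStateInSector (hubbardTorusTT' (Ls₁ j) 1 s₁ U) (rectN n (Ls₁ j)) 0 (ψ₁ (Ls₁ j))) →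
      (∀ j, star (ψ₁ (Ls₁ j)) ⬝ᵥ ψ₁ (Ls₁ j) = 1) → ω₁.IsTorusLimitOf ψ₁ Ls₁ →
      ω₁.meanEnergy (hubbardTTPrimeFermionInteraction 0 1 0) 1 ≤ A)
    (hB : ∀ (ω₂ : InfVolFermionState 2) (Ls₂ : ℕ → ℕ) (ψ₂ : ∀ L, Fock (Orb (FermionTorus 2 L))),
      Tendsto Ls₂ atTop atTop →
      (∀ j, IsGroundStateInSector (hubbardTorusTT' (Ls₂ j) 1 s₂ U) (rectN n (Ls₂ j)) 0 (ψ₂ (Ls₂ j))) →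
      (∀ j, star (ψ₂ (Ls₂ j)) ⬝ᵥ ψ₂ (Ls₂ j) = 1) → ω₂.IsTorusLimitOf ψ₂ Ls₂ →
      B ≤ ω₂.meanEnergy (hubbardTTPrimeFermionInteraction 0 1 0) 1)
    {s : ℝ} (h₁ : s₁ ≤ s) (h₂ : s ≤ s₂) :
    dWaveSourceEnergyDensityTT' s U μ h ≤
      max R₁ R₂ + (s₂ - s₁) * (max A 0 * max (-B) 0) / (max A 0 + max (-B) 0) - μ * n :=
  dWaveSourceEnergyDensityTT'_le_of_energyDensityTT'_le s hU μ h hn0 hn2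
    (energyDensityTT'_tPrime_interval_le_of_columnWords 1 hU hn0 hn2 hR₁ hR₂ hA hB h₁ h₂)

/-- **(c') Through the CANONICAL kinematic two-column cap**: canonical caps `e(1,sᵢ,U,n) ≤ Rᵢ` alone give
`E(s,U,μ,h) ≤ max R₁ R₂ + (16/π²)(s₂ − s₁)/2 − μn` on `[s₁,s₂]`. [cite: Ruelle1969, §3.4] -/
theorem dWaveSourceEnergyDensityTT'_tPrime_interval_le_of_canonical_caps_kinematic {U : ℝ} (hU : 0 ≤ U) {n : ℝ}
    (hn0 : 0 ≤ n) (hn2 : n < 2) (μ h : ℝ) {s₁ s₂ R₁ R₂ : ℝ}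
    (hR₁ : energyDensityTT' 1 s₁ U n ≤ R₁) (hR₂ : energyDensityTT' 1 s₂ U n ≤ R₂) {s : ℝ} (h₁ : s₁ ≤ s)
    (h₂ : s ≤ s₂) :
    dWaveSourceEnergyDensityTT' s U μ h ≤ max R₁ R₂ + 16 / Real.pi ^ 2 * ((s₂ - s₁) / 2) - μ * n := by
  have key := energyDensityTT'_tPrime_interval_le_kinematic 1 hU hn0 hn2 hR₁ hR₂ h₁ h₂
  rw [sub_self, sub_self, max_self, max_eq_right (by linarith : (0 : ℝ) ≤ (s₂ - s₁) / 2)] at key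
  exact dWaveSourceEnergyDensityTT'_le_of_energyDensityTT'_le s hU μ h hn0 hn2 key

end Caps

/-! ### §4 ORDER-PARAMETER CEILINGS on a whole `t'`-interval from the two anchors -/

section Order

/-- **Pointwise, canonical-cap form**: a canonical cap `e(1,s,U,n) ≤ R` (`U ≥ 0`, `0 ≤ n < 2`) and a sourced floor
`lo ≤ E(s,U,μ,h)` (`h > 0`) give `m⋆(s,U,μ) ≤ (R − μn − lo)/(2h)` (the thermodynamic-limit number form of the
venture's `dWaveOrderParameterTT'_le_of_canonical_upper_of_sourced_lower'`). [cite: KomaTasaki1994, §1] -/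
theorem dWaveOrderParameterTT'_le_of_canonicalCap_of_sourcedFloor {s U μ h n R lo : ℝ} (hh : 0 < h) (hU : 0 ≤ U)
    (hn0 : 0 ≤ n) (hn2 : n < 2) (hR : energyDensityTT' 1 s U n ≤ R) (hlo : lo ≤ dWaveSourceEnergyDensityTT' s U μ h) :
    dWaveOrderParameterTT' s U μ ≤ (R - μ * n - lo) / (2 * h) :=
  dWaveOrderParameterTT'_le_of_windows s U μ hh hlo (dWaveSourceEnergyDensityTT'_le_of_energyDensityTT'_le s hU μ 0 hn0 hn2 hR)

/-- **INTERVAL ORDER CEILING, kinematic**: source-free caps `E(sᵢ,U,μ,0) ≤ hiᵢ` and sourced floors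
`loᵢ ≤ E(sᵢ,U,μ,h)` (`h > 0`) at the two anchors give, for every `s ∈ [s₁,s₂]`,
`m⋆(s,U,μ) ≤ (max hi₁ hi₂ + (16/π²)·min(s − s₁, s₂ − s) − min lo₁ lo₂)/(2h)`. [cite: KomaTasaki1994, §1] -/
theorem dWaveOrderParameterTT'_tPrime_interval_le_kinematic {s₁ s₂ U μ h hi₁ hi₂ lo₁ lo₂ : ℝ} (hh : 0 < h)
    (hhi₁ : dWaveSourceEnergyDensityTT' s₁ U μ 0 ≤ hi₁) (hhi₂ : dWaveSourceEnergyDensityTT' s₂ U μ 0 ≤ hi₂)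
    (hlo₁ : lo₁ ≤ dWaveSourceEnergyDensityTT' s₁ U μ h) (hlo₂ : lo₂ ≤ dWaveSourceEnergyDensityTT' s₂ U μ h)
    {s : ℝ} (h₁ : s₁ ≤ s) (h₂ : s ≤ s₂) :
    dWaveOrderParameterTT' s U μ ≤
      (max hi₁ hi₂ + 16 / Real.pi ^ 2 * min (s - s₁) (s₂ - s) - min lo₁ lo₂) / (2 * h) :=
  dWaveOrderParameterTT'_le_of_windows s U μ hh (dWaveSourceEnergyDensityTT'_tPrime_interval_ge h₁ h₂ hlo₁ hlo₂)
    (dWaveSourceEnergyDensityTT'_tPrime_interval_le_kinematic h₁ h₂ hhi₁ hhi₂)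

/-- **INTERVAL ORDER CEILING, kinematic, uniform**: `m⋆(s,U,μ) ≤ (max hi₁ hi₂ + (16/π²)(s₂ − s₁)/2 − min lo₁ lo₂)/(2h)`
for every `s ∈ [s₁,s₂]`. [cite: KomaTasaki1994, §1] -/
theorem dWaveOrderParameterTT'_tPrime_interval_le_kinematic' {s₁ s₂ U μ h hi₁ hi₂ lo₁ lo₂ : ℝ} (hh : 0 < h)
    (hhi₁ : dWaveSourceEnergyDensityTT' s₁ U μ 0 ≤ hi₁) (hhi₂ : dWaveSourceEnergyDensityTT' s₂ U μ 0 ≤ hi₂)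
    (hlo₁ : lo₁ ≤ dWaveSourceEnergyDensityTT' s₁ U μ h) (hlo₂ : lo₂ ≤ dWaveSourceEnergyDensityTT' s₂ U μ h)
    {s : ℝ} (h₁ : s₁ ≤ s) (h₂ : s ≤ s₂) :
    dWaveOrderParameterTT' s U μ ≤
      (max hi₁ hi₂ + 16 / Real.pi ^ 2 * ((s₂ - s₁) / 2) - min lo₁ lo₂) / (2 * h) :=
  dWaveOrderParameterTT'_le_of_windows s U μ hh (dWaveSourceEnergyDensityTT'_tPrime_interval_ge h₁ h₂ hlo₁ hlo₂)
    (dWaveSourceEnergyDensityTT'_tPrime_interval_le_kinematic' h₁ h₂ hhi₁ hhi₂)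

/-- **THE CUPRATE `t'`-INTERVAL `[−1/4, 0]` FROM ITS TWO ANCHORS** (kinematic): for `−1/4 ≤ s ≤ 0`,
`m⋆(s,U,μ) ≤ (max hi₁ hi₂ + 2/π² − min lo₁ lo₂)/(2h)` — the whole interval for one bulge `(16/π²)/8 = 2/π² ≈ 0.2026`
in energy units. [cite: KomaTasaki1994, §1] -/
theorem dWaveOrderParameterTT'_cuprate_tPrime_interval_le_kinematic {U μ h hi₁ hi₂ lo₁ lo₂ : ℝ} (hh : 0 < h)
    (hhi₁ : dWaveSourceEnergyDensityTT' (-1 / 4) U μ 0 ≤ hi₁) (hhi₂ : dWaveSourceEnergyDensityTT' 0 U μ 0 ≤ hi₂)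
    (hlo₁ : lo₁ ≤ dWaveSourceEnergyDensityTT' (-1 / 4) U μ h) (hlo₂ : lo₂ ≤ dWaveSourceEnergyDensityTT' 0 U μ h)
    {s : ℝ} (h₁ : -1 / 4 ≤ s) (h₂ : s ≤ 0) :
    dWaveOrderParameterTT' s U μ ≤ (max hi₁ hi₂ + 2 / Real.pi ^ 2 - min lo₁ lo₂) / (2 * h) := by
  have key := dWaveOrderParameterTT'_tPrime_interval_le_kinematic' hh hhi₁ hhi₂ hlo₁ hlo₂ h₁ h₂
  have h8 : 16 / Real.pi ^ 2 * ((0 - (-1 / 4 : ℝ)) / 2) = 2 / Real.pi ^ 2 := by ring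
  rwa [h8] at key

/-- **INTERVAL ORDER CEILING from `K₂`-WORDS on the source-free ground states**: with the tangent words of
§3 (b) at `h = 0` (every translation-invariant grand-canonical ground state at `s₁` has `K₂ ≤ A`, at `s₂` has
`K₂ ≥ B`): `m⋆(s,U,μ) ≤ (max hi₁ hi₂ + (s₂ − s₁)·A⁺(−B)⁺/(A⁺ + (−B)⁺) − min lo₁ lo₂)/(2h)` on `[s₁,s₂]`.
[cite: KomaTasaki1994, §1] -/
theorem dWaveOrderParameterTT'_tPrime_interval_le_of_diagHopWords {s₁ s₂ U μ h hi₁ hi₂ lo₁ lo₂ A B : ℝ}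
    (hh : 0 < h) (hhi₁ : dWaveSourceEnergyDensityTT' s₁ U μ 0 ≤ hi₁)
    (hhi₂ : dWaveSourceEnergyDensityTT' s₂ U μ 0 ≤ hi₂)
    (hA : ∀ ω : InfVolFermionState 2,
      ω.IsMeanEnergyMinimiser (hubbardTTPrimeSourcedInteraction 1 s₁ U μ dWaveFormFactor 0) 1 →
        ω.meanEnergy (hubbardTTPrimeFermionInteraction 0 1 0) 1 ≤ A)
    (hB : ∀ ω : InfVolFermionState 2,
      ω.IsMeanEnergyMinimiser (hubbardTTPrimeSourcedInteraction 1 s₂ U μ dWaveFormFactor 0) 1 →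
        B ≤ ω.meanEnergy (hubbardTTPrimeFermionInteraction 0 1 0) 1)
    (hlo₁ : lo₁ ≤ dWaveSourceEnergyDensityTT' s₁ U μ h) (hlo₂ : lo₂ ≤ dWaveSourceEnergyDensityTT' s₂ U μ h)
    {s : ℝ} (h₁ : s₁ ≤ s) (h₂ : s ≤ s₂) :
    dWaveOrderParameterTT' s U μ ≤
      (max hi₁ hi₂ + (s₂ - s₁) * (max A 0 * max (-B) 0) / (max A 0 + max (-B) 0) - min lo₁ lo₂) / (2 * h) :=
  dWaveOrderParameterTT'_le_of_windows s U μ hh (dWaveSourceEnergyDensityTT'_tPrime_interval_ge h₁ h₂ hlo₁ hlo₂)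
    (dWaveSourceEnergyDensityTT'_tPrime_interval_le_of_diagHopWords h₁ h₂ hhi₁ hhi₂ hA hB)

/-- **INTERVAL ORDER CEILING through the CANONICAL two-column words** (registry rows BY NAME feed `Rᵢ`, `A`, `B`):
`m⋆(s,U,μ) ≤ (max R₁ R₂ + (s₂ − s₁)·A⁺(−B)⁺/(A⁺ + (−B)⁺) − μn − min lo₁ lo₂)/(2h)` on `[s₁,s₂]`, `U ≥ 0`, `0 ≤ n < 2`.
[cite: KomaTasaki1994, §1] -/
theorem dWaveOrderParameterTT'_tPrime_interval_le_of_canonical_columnWords {U : ℝ} (hU : 0 ≤ U) {n : ℝ}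
    (hn0 : 0 ≤ n) (hn2 : n < 2) {μ h : ℝ} (hh : 0 < h) {s₁ s₂ R₁ R₂ A B lo₁ lo₂ : ℝ}
    (hR₁ : energyDensityTT' 1 s₁ U n ≤ R₁) (hR₂ : energyDensityTT' 1 s₂ U n ≤ R₂)
    (hA : ∀ (ω₁ : InfVolFermionState 2) (Ls₁ : ℕ → ℕ) (ψ₁ : ∀ L, Fock (Orb (FermionTorus 2 L))),
      Tendsto Ls₁ atTop atTop →
      (∀ j, IsGroundStateInSector (hubbardTorusTT' (Ls₁ j) 1 s₁ U) (rectN n (Ls₁ j)) 0 (ψ₁ (Ls₁ j))) →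
      (∀ j, star (ψ₁ (Ls₁ j)) ⬝ᵥ ψ₁ (Ls₁ j) = 1) → ω₁.IsTorusLimitOf ψ₁ Ls₁ →
      ω₁.meanEnergy (hubbardTTPrimeFermionInteraction 0 1 0) 1 ≤ A)
    (hB : ∀ (ω₂ : InfVolFermionState 2) (Ls₂ : ℕ → ℕ) (ψ₂ : ∀ L, Fock (Orb (FermionTorus 2 L))),
      Tendsto Ls₂ atTop atTop →
      (∀ j, IsGroundStateInSector (hubbardTorusTT' (Ls₂ j) 1 s₂ U) (rectN n (Ls₂ j)) 0 (ψ₂ (Ls₂ j))) →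
      (∀ j, star (ψ₂ (Ls₂ j)) ⬝ᵥ ψ₂ (Ls₂ j) = 1) → ω₂.IsTorusLimitOf ψ₂ Ls₂ →
      B ≤ ω₂.meanEnergy (hubbardTTPrimeFermionInteraction 0 1 0) 1)
    (hlo₁ : lo₁ ≤ dWaveSourceEnergyDensityTT' s₁ U μ h) (hlo₂ : lo₂ ≤ dWaveSourceEnergyDensityTT' s₂ U μ h)
    {s : ℝ} (h₁ : s₁ ≤ s) (h₂ : s ≤ s₂) :
    dWaveOrderParameterTT' s U μ ≤
      (max R₁ R₂ + (s₂ - s₁) * (max A 0 * max (-B) 0) / (max A 0 + max (-B) 0) - μ * n - min lo₁ lo₂) /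
        (2 * h) :=
  dWaveOrderParameterTT'_le_of_windows s U μ hh (dWaveSourceEnergyDensityTT'_tPrime_interval_ge h₁ h₂ hlo₁ hlo₂)
    (dWaveSourceEnergyDensityTT'_tPrime_interval_le_of_canonical_columnWords hU hn0 hn2 μ 0 hR₁ hR₂ hA hB h₁ h₂)

/-- **INTERVAL ORDER CEILING through the CANONICAL kinematic two-column cap**:
`m⋆(s,U,μ) ≤ (max R₁ R₂ + (16/π²)(s₂ − s₁)/2 − μn − min lo₁ lo₂)/(2h)` on `[s₁,s₂]`. [cite: KomaTasaki1994, §1] -/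
theorem dWaveOrderParameterTT'_tPrime_interval_le_of_canonical_caps_kinematic {U : ℝ} (hU : 0 ≤ U) {n : ℝ}
    (hn0 : 0 ≤ n) (hn2 : n < 2) {μ h : ℝ} (hh : 0 < h) {s₁ s₂ R₁ R₂ lo₁ lo₂ : ℝ}
    (hR₁ : energyDensityTT' 1 s₁ U n ≤ R₁) (hR₂ : energyDensityTT' 1 s₂ U n ≤ R₂)
    (hlo₁ : lo₁ ≤ dWaveSourceEnergyDensityTT' s₁ U μ h) (hlo₂ : lo₂ ≤ dWaveSourceEnergyDensityTT' s₂ U μ h)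
    {s : ℝ} (h₁ : s₁ ≤ s) (h₂ : s ≤ s₂) :
    dWaveOrderParameterTT' s U μ ≤
      (max R₁ R₂ + 16 / Real.pi ^ 2 * ((s₂ - s₁) / 2) - μ * n - min lo₁ lo₂) / (2 * h) :=
  dWaveOrderParameterTT'_le_of_windows s U μ hh (dWaveSourceEnergyDensityTT'_tPrime_interval_ge h₁ h₂ hlo₁ hlo₂)
    (dWaveSourceEnergyDensityTT'_tPrime_interval_le_of_canonical_caps_kinematic hU hn0 hn2 μ 0 hR₁ hR₂ h₁ h₂)

/-- **INTERVAL ORDER CEILING from ANY canonical interval cap** (the fast cell's `t'`-cell words, chord/tangent/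
secant laws, whatever certifies `e(1,s,U,n) ≤ R` on `[s₁,s₂]`): `m⋆(s,U,μ) ≤ (R − μn − min lo₁ lo₂)/(2h)` on `[s₁,s₂]`.
[cite: KomaTasaki1994, §1] -/
theorem dWaveOrderParameterTT'_tPrime_interval_le_of_canonical_intervalCap {U : ℝ} (hU : 0 ≤ U) {n : ℝ}
    (hn0 : 0 ≤ n) (hn2 : n < 2) {μ h : ℝ} (hh : 0 < h) {s₁ s₂ R lo₁ lo₂ : ℝ}
    (hR : ∀ s ∈ Set.Icc s₁ s₂, energyDensityTT' 1 s U n ≤ R)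
    (hlo₁ : lo₁ ≤ dWaveSourceEnergyDensityTT' s₁ U μ h) (hlo₂ : lo₂ ≤ dWaveSourceEnergyDensityTT' s₂ U μ h)
    {s : ℝ} (h₁ : s₁ ≤ s) (h₂ : s ≤ s₂) :
    dWaveOrderParameterTT' s U μ ≤ (R - μ * n - min lo₁ lo₂) / (2 * h) :=
  dWaveOrderParameterTT'_le_of_canonicalCap_of_sourcedFloor hh hU hn0 hn2 (hR s ⟨h₁, h₂⟩)
    (dWaveSourceEnergyDensityTT'_tPrime_interval_ge h₁ h₂ hlo₁ hlo₂)

/-- **ABSENT(`< m₀`) ON THE WHOLE INTERVAL, kinematic**: if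
`max hi₁ hi₂ + (16/π²)(s₂ − s₁)/2 − min lo₁ lo₂ < 2h·m₀` then `m⋆(s,U,μ) < m₀` for every `s ∈ [s₁,s₂]`.
[cite: KomaTasaki1994, §1] -/
theorem dWaveOrderParameterTT'_lt_on_tPrime_interval_kinematic {s₁ s₂ U μ h hi₁ hi₂ lo₁ lo₂ m₀ : ℝ} (hh : 0 < h)
    (hhi₁ : dWaveSourceEnergyDensityTT' s₁ U μ 0 ≤ hi₁) (hhi₂ : dWaveSourceEnergyDensityTT' s₂ U μ 0 ≤ hi₂)
    (hlo₁ : lo₁ ≤ dWaveSourceEnergyDensityTT' s₁ U μ h) (hlo₂ : lo₂ ≤ dWaveSourceEnergyDensityTT' s₂ U μ h)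
    (habs : max hi₁ hi₂ + 16 / Real.pi ^ 2 * ((s₂ - s₁) / 2) - min lo₁ lo₂ < 2 * h * m₀)
    {s : ℝ} (h₁ : s₁ ≤ s) (h₂ : s ≤ s₂) :
    dWaveOrderParameterTT' s U μ < m₀ := by
  refine lt_of_le_of_lt (dWaveOrderParameterTT'_tPrime_interval_le_kinematic' hh hhi₁ hhi₂ hlo₁ hlo₂ h₁ h₂) ?_
  rw [div_lt_iff₀ (by positivity)]
  linarith

/-- **ABSENT(`< m₀`) ON THE WHOLE INTERVAL from a canonical interval cap**: if `R − μn − min lo₁ lo₂ < 2h·m₀`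
then `m⋆(s,U,μ) < m₀` on `[s₁,s₂]`. [cite: KomaTasaki1994, §1] -/
theorem dWaveOrderParameterTT'_lt_on_tPrime_interval_of_canonical_intervalCap {U : ℝ} (hU : 0 ≤ U) {n : ℝ}
    (hn0 : 0 ≤ n) (hn2 : n < 2) {μ h : ℝ} (hh : 0 < h) {s₁ s₂ R lo₁ lo₂ m₀ : ℝ}
    (hR : ∀ s ∈ Set.Icc s₁ s₂, energyDensityTT' 1 s U n ≤ R)
    (hlo₁ : lo₁ ≤ dWaveSourceEnergyDensityTT' s₁ U μ h) (hlo₂ : lo₂ ≤ dWaveSourceEnergyDensityTT' s₂ U μ h)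
    (habs : R - μ * n - min lo₁ lo₂ < 2 * h * m₀) {s : ℝ} (h₁ : s₁ ≤ s) (h₂ : s ≤ s₂) :
    dWaveOrderParameterTT' s U μ < m₀ := by
  refine lt_of_le_of_lt
    (dWaveOrderParameterTT'_tPrime_interval_le_of_canonical_intervalCap hU hn0 hn2 hh hR hlo₁ hlo₂ h₁ h₂) ?_
  rw [div_lt_iff₀ (by positivity)]
  linarith

/-- **SKEW ANCHORS (different `μ`, `h`, even `U`, at the two anchors)**: for convex weights `p, q` the target
`c = p c₁ + q c₂` on the segment between the anchor coupling points `cᵢ = (tpᵢ, Uᵢ, μᵢ, hᵢ)` inherits the sourced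
floor `p lo₁ + q lo₂` by JOINT concavity, and a canonical cap `e(1, t'_c, U_c, n) ≤ R` at the target (`U_c ≥ 0`,
`0 ≤ n < 2`) closes the ceiling at the interpolated field `h_c = p h₁ + q h₂ > 0`:
`m⋆(t'_c, U_c, μ_c) ≤ (R − μ_c n − (p lo₁ + q lo₂))/(2 h_c)` — the form for two cuprate anchors certified at
different chemical potentials / sources. [cite: KomaTasaki1994, §1] -/
theorem dWaveOrderParameterTT'_segment_le_of_canonicalCap {tp₁ U₁ μ₁ h₁ tp₂ U₂ μ₂ h₂ lo₁ lo₂ p q n R : ℝ}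
    (hp : 0 ≤ p) (hq : 0 ≤ q) (hpq : p + q = 1) (hh : 0 < p * h₁ + q * h₂) (hU : 0 ≤ p * U₁ + q * U₂)
    (hn0 : 0 ≤ n) (hn2 : n < 2) (hlo₁ : lo₁ ≤ dWaveSourceEnergyDensityTT' tp₁ U₁ μ₁ h₁)
    (hlo₂ : lo₂ ≤ dWaveSourceEnergyDensityTT' tp₂ U₂ μ₂ h₂)
    (hR : energyDensityTT' 1 (p * tp₁ + q * tp₂) (p * U₁ + q * U₂) n ≤ R) :
    dWaveOrderParameterTT' (p * tp₁ + q * tp₂) (p * U₁ + q * U₂) (p * μ₁ + q * μ₂) ≤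
      (R - (p * μ₁ + q * μ₂) * n - (p * lo₁ + q * lo₂)) / (2 * (p * h₁ + q * h₂)) := by
  have key := dWaveSourceEnergyDensityTT'_convexComb_couplings_ge (tp₁ := tp₁) (U₁ := U₁) (μ₁ := μ₁) (h₁ := h₁)
    (tp₂ := tp₂) (U₂ := U₂) (μ₂ := μ₂) (h₂ := h₂) hp hq hpq
  have e1 := mul_le_mul_of_nonneg_left hlo₁ hp
  have e2 := mul_le_mul_of_nonneg_left hlo₂ hq
  exact dWaveOrderParameterTT'_le_of_canonicalCap_of_sourcedFloor hh hU hn0 hn2 hR ((add_le_add e1 e2).trans key)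

/-- **SKEW ANCHORS, sourced-cap form**: the same with a source-free cap `E(t'_c, U_c, μ_c, 0) ≤ hi` at the target
(e.g. from §3 at the target's own `μ_c`). [cite: KomaTasaki1994, §1] -/
theorem dWaveOrderParameterTT'_segment_le_of_cap {tp₁ U₁ μ₁ h₁ tp₂ U₂ μ₂ h₂ lo₁ lo₂ p q hi : ℝ}
    (hp : 0 ≤ p) (hq : 0 ≤ q) (hpq : p + q = 1) (hh : 0 < p * h₁ + q * h₂)
    (hlo₁ : lo₁ ≤ dWaveSourceEnergyDensityTT' tp₁ U₁ μ₁ h₁)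
    (hlo₂ : lo₂ ≤ dWaveSourceEnergyDensityTT' tp₂ U₂ μ₂ h₂)
    (hhi : dWaveSourceEnergyDensityTT' (p * tp₁ + q * tp₂) (p * U₁ + q * U₂) (p * μ₁ + q * μ₂) 0 ≤ hi) :
    dWaveOrderParameterTT' (p * tp₁ + q * tp₂) (p * U₁ + q * U₂) (p * μ₁ + q * μ₂) ≤
      (hi - (p * lo₁ + q * lo₂)) / (2 * (p * h₁ + q * h₂)) := by
  have key := dWaveSourceEnergyDensityTT'_convexComb_couplings_ge (tp₁ := tp₁) (U₁ := U₁) (μ₁ := μ₁) (h₁ := h₁)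
    (tp₂ := tp₂) (U₂ := U₂) (μ₂ := μ₂) (h₂ := h₂) hp hq hpq
  have e1 := mul_le_mul_of_nonneg_left hlo₁ hp
  have e2 := mul_le_mul_of_nonneg_left hlo₂ hq
  exact dWaveOrderParameterTT'_le_of_windows _ _ _ hh ((add_le_add e1 e2).trans key) hhi

end Order

/-! ### §5 `(t', U, μ)` cells from four certificates (monotonicity in `U` and `μ`) -/

section Cells

/-- **Rectangle floor from the two LOWER-`U`, UPPER-`μ` corners**: floors at `(s₁,U₁,μ₂,h)` and `(s₂,U₁,μ₂,h)` floor
`E` on `[s₁,s₂] × [U₁,∞) × (−∞,μ₂]` (concave in `t'`, non-decreasing in `U`, non-increasing in `μ`).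
[cite: Israel1979, Thm. I.3.4] -/
theorem dWaveSourceEnergyDensityTT'_box_ge_of_lowerCorners {s₁ s₂ U₁ μ₂ h lo₁ lo₂ s U μ : ℝ} (h₁ : s₁ ≤ s)
    (h₂ : s ≤ s₂) (hU : U₁ ≤ U) (hμ : μ ≤ μ₂) (hlo₁ : lo₁ ≤ dWaveSourceEnergyDensityTT' s₁ U₁ μ₂ h)
    (hlo₂ : lo₂ ≤ dWaveSourceEnergyDensityTT' s₂ U₁ μ₂ h) :
    min lo₁ lo₂ ≤ dWaveSourceEnergyDensityTT' s U μ h :=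
  ((dWaveSourceEnergyDensityTT'_tPrime_interval_ge h₁ h₂ hlo₁ hlo₂).trans
    (dWaveSourceEnergyDensityTT'_mono_U s μ₂ h hU)).trans (dWaveSourceEnergyDensityTT'_antitone_mu s U h hμ)

/-- **Rectangle cap from the two UPPER-`U`, LOWER-`μ` corners (kinematic bulge)**: caps at `(s₁,U₂,μ₁,h)`,
`(s₂,U₂,μ₁,h)` cap `E` on `[s₁,s₂] × (−∞,U₂] × [μ₁,∞)`: `E ≤ max hi₁ hi₂ + (16/π²)(s₂ − s₁)/2`.
[cite: Israel1979, Thm. I.3.4] -/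
theorem dWaveSourceEnergyDensityTT'_box_le_of_upperCorners_kinematic {s₁ s₂ U₂ μ₁ h hi₁ hi₂ s U μ : ℝ}
    (h₁ : s₁ ≤ s) (h₂ : s ≤ s₂) (hU : U ≤ U₂) (hμ : μ₁ ≤ μ)
    (hhi₁ : dWaveSourceEnergyDensityTT' s₁ U₂ μ₁ h ≤ hi₁) (hhi₂ : dWaveSourceEnergyDensityTT' s₂ U₂ μ₁ h ≤ hi₂) :
    dWaveSourceEnergyDensityTT' s U μ h ≤ max hi₁ hi₂ + 16 / Real.pi ^ 2 * ((s₂ - s₁) / 2) :=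
  ((dWaveSourceEnergyDensityTT'_antitone_mu s U h hμ).trans (dWaveSourceEnergyDensityTT'_mono_U s μ₁ h hU)).trans
    (dWaveSourceEnergyDensityTT'_tPrime_interval_le_kinematic' h₁ h₂ hhi₁ hhi₂)

/-- **ORDER CEILING ON A `(t', U)` RECTANGLE from four certificates (kinematic `t'`-bulge, nothing in `U`)**:
source-free caps at the two upper-`U` corners `(sᵢ,U₂,μ,0)` and sourced floors at the two lower-`U` corners
`(sᵢ,U₁,μ,h)` give `m⋆(s,U,μ) ≤ (max hi₁ hi₂ + (16/π²)(s₂ − s₁)/2 − min lo₁ lo₂)/(2h)` on `[s₁,s₂] × [U₁,U₂]`.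
[cite: KomaTasaki1994, §1] -/
theorem dWaveOrderParameterTT'_rect_le_of_cornerWindows_kinematic {s₁ s₂ U₁ U₂ μ h hi₁ hi₂ lo₁ lo₂ : ℝ}
    (hh : 0 < h) (hhi₁ : dWaveSourceEnergyDensityTT' s₁ U₂ μ 0 ≤ hi₁)
    (hhi₂ : dWaveSourceEnergyDensityTT' s₂ U₂ μ 0 ≤ hi₂) (hlo₁ : lo₁ ≤ dWaveSourceEnergyDensityTT' s₁ U₁ μ h)
    (hlo₂ : lo₂ ≤ dWaveSourceEnergyDensityTT' s₂ U₁ μ h) {s U : ℝ} (h₁ : s₁ ≤ s) (h₂ : s ≤ s₂) (hU₁ : U₁ ≤ U)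
    (hU₂ : U ≤ U₂) :
    dWaveOrderParameterTT' s U μ ≤
      (max hi₁ hi₂ + 16 / Real.pi ^ 2 * ((s₂ - s₁) / 2) - min lo₁ lo₂) / (2 * h) :=
  dWaveOrderParameterTT'_le_of_windows s U μ hh
    (dWaveSourceEnergyDensityTT'_box_ge_of_lowerCorners h₁ h₂ hU₁ le_rfl hlo₁ hlo₂)
    (dWaveSourceEnergyDensityTT'_box_le_of_upperCorners_kinematic h₁ h₂ hU₂ le_rfl hhi₁ hhi₂)

/-- **ORDER CEILING ON A `(t', U, μ)` CELL from four certificates**: source-free caps at the corners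
`(sᵢ, U₂, μ₁)` and sourced floors (`h > 0`) at `(sᵢ, U₁, μ₂)` give, on the whole cell
`[s₁,s₂] × [U₁,U₂] × [μ₁,μ₂]`, `m⋆(s,U,μ) ≤ (max hi₁ hi₂ + (16/π²)(s₂ − s₁)/2 − min lo₁ lo₂)/(2h)` — the price in
`U` and `μ` is only the physical variation between the opposite corners, no kinematic constant. [cite: KomaTasaki1994, §1] -/
theorem dWaveOrderParameterTT'_box₃_le_of_cornerWindows_kinematic {s₁ s₂ U₁ U₂ μ₁ μ₂ h hi₁ hi₂ lo₁ lo₂ : ℝ}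
    (hh : 0 < h) (hhi₁ : dWaveSourceEnergyDensityTT' s₁ U₂ μ₁ 0 ≤ hi₁)
    (hhi₂ : dWaveSourceEnergyDensityTT' s₂ U₂ μ₁ 0 ≤ hi₂) (hlo₁ : lo₁ ≤ dWaveSourceEnergyDensityTT' s₁ U₁ μ₂ h)
    (hlo₂ : lo₂ ≤ dWaveSourceEnergyDensityTT' s₂ U₁ μ₂ h) {s U μ : ℝ} (h₁ : s₁ ≤ s) (h₂ : s ≤ s₂)
    (hU₁ : U₁ ≤ U) (hU₂ : U ≤ U₂) (hμ₁ : μ₁ ≤ μ) (hμ₂ : μ ≤ μ₂) :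
    dWaveOrderParameterTT' s U μ ≤
      (max hi₁ hi₂ + 16 / Real.pi ^ 2 * ((s₂ - s₁) / 2) - min lo₁ lo₂) / (2 * h) :=
  dWaveOrderParameterTT'_le_of_windows s U μ hh
    (dWaveSourceEnergyDensityTT'_box_ge_of_lowerCorners h₁ h₂ hU₁ hμ₂ hlo₁ hlo₂)
    (dWaveSourceEnergyDensityTT'_box_le_of_upperCorners_kinematic h₁ h₂ hU₂ hμ₁ hhi₁ hhi₂)

/-- **ORDER CEILING ON A `(t', U, μ)` CELL, canonical cap edition**: a canonical interval cap
`e(1,s,U₂,n) ≤ R` on `[s₁,s₂]` at the upper edge `U₂ ≥ 0` (`0 ≤ n < 2`) and two sourced floors at `(sᵢ,U₁,μ₂,h)` give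
`m⋆(s,U,μ) ≤ (R − μ₁ n − min lo₁ lo₂)/(2h)` on `[s₁,s₂] × [U₁,U₂] × [μ₁,μ₂]`. [cite: KomaTasaki1994, §1] -/
theorem dWaveOrderParameterTT'_box₃_le_of_canonical_intervalCap {U₂ : ℝ} (hU₂0 : 0 ≤ U₂) {n : ℝ} (hn0 : 0 ≤ n)
    (hn2 : n < 2) {h : ℝ} (hh : 0 < h) {s₁ s₂ U₁ μ₁ μ₂ R lo₁ lo₂ : ℝ}
    (hR : ∀ s ∈ Set.Icc s₁ s₂, energyDensityTT' 1 s U₂ n ≤ R)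
    (hlo₁ : lo₁ ≤ dWaveSourceEnergyDensityTT' s₁ U₁ μ₂ h) (hlo₂ : lo₂ ≤ dWaveSourceEnergyDensityTT' s₂ U₁ μ₂ h)
    {s U μ : ℝ} (h₁ : s₁ ≤ s) (h₂ : s ≤ s₂) (hU₁ : U₁ ≤ U) (hU₂ : U ≤ U₂) (hμ₁ : μ₁ ≤ μ) (hμ₂ : μ ≤ μ₂) :
    dWaveOrderParameterTT' s U μ ≤ (R - μ₁ * n - min lo₁ lo₂) / (2 * h) := by
  have hcap : dWaveSourceEnergyDensityTT' s U μ 0 ≤ R - μ₁ * n :=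
    ((dWaveSourceEnergyDensityTT'_antitone_mu s U 0 hμ₁).trans (dWaveSourceEnergyDensityTT'_mono_U s μ₁ 0 hU₂)).trans
      (dWaveSourceEnergyDensityTT'_le_of_energyDensityTT'_le s hU₂0 μ₁ 0 hn0 hn2 (hR s ⟨h₁, h₂⟩))
  exact dWaveOrderParameterTT'_le_of_windows s U μ hh
    (dWaveSourceEnergyDensityTT'_box_ge_of_lowerCorners h₁ h₂ hU₁ hμ₂ hlo₁ hlo₂) hcap

/-- **ABSENT(`< m₀`) ON A WHOLE `(t', U, μ)` CELL** (kinematic edition): if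
`max hi₁ hi₂ + (16/π²)(s₂ − s₁)/2 − min lo₁ lo₂ < 2h·m₀` then `m⋆ < m₀` on `[s₁,s₂] × [U₁,U₂] × [μ₁,μ₂]`.
[cite: KomaTasaki1994, §1] -/
theorem dWaveOrderParameterTT'_lt_on_box₃_kinematic {s₁ s₂ U₁ U₂ μ₁ μ₂ h hi₁ hi₂ lo₁ lo₂ m₀ : ℝ} (hh : 0 < h)
    (hhi₁ : dWaveSourceEnergyDensityTT' s₁ U₂ μ₁ 0 ≤ hi₁) (hhi₂ : dWaveSourceEnergyDensityTT' s₂ U₂ μ₁ 0 ≤ hi₂)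
    (hlo₁ : lo₁ ≤ dWaveSourceEnergyDensityTT' s₁ U₁ μ₂ h) (hlo₂ : lo₂ ≤ dWaveSourceEnergyDensityTT' s₂ U₁ μ₂ h)
    (habs : max hi₁ hi₂ + 16 / Real.pi ^ 2 * ((s₂ - s₁) / 2) - min lo₁ lo₂ < 2 * h * m₀) {s U μ : ℝ}
    (h₁ : s₁ ≤ s) (h₂ : s ≤ s₂) (hU₁ : U₁ ≤ U) (hU₂ : U ≤ U₂) (hμ₁ : μ₁ ≤ μ) (hμ₂ : μ ≤ μ₂) :
    dWaveOrderParameterTT' s U μ < m₀ := by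
  refine lt_of_le_of_lt
    (dWaveOrderParameterTT'_box₃_le_of_cornerWindows_kinematic hh hhi₁ hhi₂ hlo₁ hlo₂ h₁ h₂ hU₁ hU₂ hμ₁ hμ₂) ?_
  rw [div_lt_iff₀ (by positivity)]
  linarith

/-- **ABSENT(`< m₀`) ON A WHOLE `(t', U, μ)` CELL** (canonical cap edition): if `R − μ₁ n − min lo₁ lo₂ < 2h·m₀`
then `m⋆ < m₀` on `[s₁,s₂] × [U₁,U₂] × [μ₁,μ₂]`. [cite: KomaTasaki1994, §1] -/
theorem dWaveOrderParameterTT'_lt_on_box₃_of_canonical_intervalCap {U₂ : ℝ} (hU₂0 : 0 ≤ U₂) {n : ℝ}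
    (hn0 : 0 ≤ n) (hn2 : n < 2) {h : ℝ} (hh : 0 < h) {s₁ s₂ U₁ μ₁ μ₂ R lo₁ lo₂ m₀ : ℝ}
    (hR : ∀ s ∈ Set.Icc s₁ s₂, energyDensityTT' 1 s U₂ n ≤ R)
    (hlo₁ : lo₁ ≤ dWaveSourceEnergyDensityTT' s₁ U₁ μ₂ h) (hlo₂ : lo₂ ≤ dWaveSourceEnergyDensityTT' s₂ U₁ μ₂ h)
    (habs : R - μ₁ * n - min lo₁ lo₂ < 2 * h * m₀) {s U μ : ℝ} (h₁ : s₁ ≤ s) (h₂ : s ≤ s₂) (hU₁ : U₁ ≤ U)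
    (hU₂ : U ≤ U₂) (hμ₁ : μ₁ ≤ μ) (hμ₂ : μ ≤ μ₂) :
    dWaveOrderParameterTT' s U μ < m₀ := by
  refine lt_of_le_of_lt (dWaveOrderParameterTT'_box₃_le_of_canonical_intervalCap hU₂0 hn0 hn2 hh hR hlo₁ hlo₂
    h₁ h₂ hU₁ hU₂ hμ₁ hμ₂) ?_
  rw [div_lt_iff₀ (by positivity)]
  linarith

end Cells

/-! ### §6 Decimal readings an engine may carry (`16/π² < 1.6212`, `2/π² < 0.2027`, `32/π² < 3.2424`) -/

section Decimal

/-- `16/π² < 1.6212` (from `π > 3.141592`). [folklore] -/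
private theorem sixteen_div_pi_sq_lt' : 16 / Real.pi ^ 2 < (1.6212 : ℝ) := by
  have hπ := Real.pi_gt_d6
  have hπ2 : (3.141592 : ℝ) ^ 2 < Real.pi ^ 2 := by
    have h0 : (0 : ℝ) ≤ 3.141592 := by norm_num
    nlinarith
  rw [div_lt_iff₀ (by positivity)]
  nlinarith

/-- **Decimal `t'`-Lipschitz law of the sourced density**: `|E(t') − E(t'')| ≤ 1.6212·|t' − t''|`.
[cite: Israel1979, Thm. I.3.4] -/
theorem abs_dWaveSourceEnergyDensityTT'_sub_tp_le_decimal (U μ h t' t'' : ℝ) :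
    |dWaveSourceEnergyDensityTT' t' U μ h - dWaveSourceEnergyDensityTT' t'' U μ h| ≤ 1.6212 * |t' - t''| := by
  refine (abs_dWaveSourceEnergyDensityTT'_sub_tp_le_kinematic U μ h t' t'').trans ?_
  exact mul_le_mul_of_nonneg_right sixteen_div_pi_sq_lt'.le (abs_nonneg _)

/-- **Decimal cuprate interval**: for `−1/4 ≤ s ≤ 0`, `m⋆(s,U,μ) ≤ (max hi₁ hi₂ + 0.2027 − min lo₁ lo₂)/(2h)`.
[cite: KomaTasaki1994, §1] -/
theorem dWaveOrderParameterTT'_cuprate_tPrime_interval_le_decimal {U μ h hi₁ hi₂ lo₁ lo₂ : ℝ} (hh : 0 < h)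
    (hhi₁ : dWaveSourceEnergyDensityTT' (-1 / 4) U μ 0 ≤ hi₁) (hhi₂ : dWaveSourceEnergyDensityTT' 0 U μ 0 ≤ hi₂)
    (hlo₁ : lo₁ ≤ dWaveSourceEnergyDensityTT' (-1 / 4) U μ h) (hlo₂ : lo₂ ≤ dWaveSourceEnergyDensityTT' 0 U μ h)
    {s : ℝ} (h₁ : -1 / 4 ≤ s) (h₂ : s ≤ 0) :
    dWaveOrderParameterTT' s U μ ≤ (max hi₁ hi₂ + 0.2027 - min lo₁ lo₂) / (2 * h) := by
  refine (dWaveOrderParameterTT'_cuprate_tPrime_interval_le_kinematic hh hhi₁ hhi₂ hlo₁ hlo₂ h₁ h₂).trans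
    (div_le_div_of_nonneg_right ?_ (by positivity))
  have h8 : 2 / Real.pi ^ 2 = 16 / Real.pi ^ 2 / 8 := by ring
  have h9 : 2 / Real.pi ^ 2 < 0.2027 := by rw [h8]; linarith [sixteen_div_pi_sq_lt']
  linarith

/-- **Decimal one-anchor `t'`-box**: `|t'' − t'| ≤ r ⇒ m⋆(t'',U,μ) ≤ (hi₀ − lo + 3.2424·r)/(2h)` (`32/π² < 3.2424`).
[cite: Israel1979, Thm. I.3.4] -/
theorem dWaveOrderParameterTT'_le_of_windows_tp_box_decimal {t' U μ h hi₀ lo r : ℝ} (hh : 0 < h)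
    (hhi : dWaveSourceEnergyDensityTT' t' U μ 0 ≤ hi₀) (hlo : lo ≤ dWaveSourceEnergyDensityTT' t' U μ h)
    {t'' : ℝ} (hr : |t'' - t'| ≤ r) :
    dWaveOrderParameterTT' t'' U μ ≤ (hi₀ - lo + 3.2424 * r) / (2 * h) := by
  have hr0 : 0 ≤ r := (abs_nonneg _).trans hr
  refine (dWaveOrderParameterTT'_le_of_windows_tp_box_kinematic hh hhi hlo hr).trans
    (div_le_div_of_nonneg_right ?_ (by positivity))
  have h9 : 32 / Real.pi ^ 2 ≤ 3.2424 := by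
    have h8 : 32 / Real.pi ^ 2 = 2 * (16 / Real.pi ^ 2) := by ring
    rw [h8]; linarith [sixteen_div_pi_sq_lt']
  nlinarith [mul_le_mul_of_nonneg_right h9 hr0]

end Decimal

end Literature.MathematicalPhysics.QuantumLattice

end
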